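import Literature.Geometry.Riemannian.CompositeChartEnergy
import Literature.Geometry.Riemannian.BoundaryFlatteningChart
import Literature.Geometry.Lorentzian.ChartPieceInequalities
import HarnessLib

/-!
# Poincaré–Wirtinger on convex composite chart pieces

Topic `Geometry/Riemannian`. Theorem file (no definitions, no named facts; everything proved): the
composite-chart analogue of `Lorentzian.exists_poincare_chartPiece`. Let `h` be a smooth
Riemannian metric on a manifold `M` modelled on `ℝᵐ`, `φ = extChartAt (𝓡 m) x`, `Ψ` a `C^∞` local
diffeomorphism of `ℝᵐ` with `Ψ.source ⊆ φ.target`, and `Q ⊆ ℝᵐ` open, convex, nonempty, with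
compact closure inside `Ψ.target`; put `P = φ.source ∩ φ⁻¹(Ψ⁻¹ Q)` (a "composite piece"). Then
there is `C < ∞` with

  `‖f − ⨍_P f dμ_h‖_{L²(P, μ_h)} ≤ C (∫_P h⁻¹(df, df) dμ_h)^{1/2}`   for every `f ∈ C¹(M)`

(`exists_poincare_compositePiece`). Proof exactly as for chart pieces (Hebey 1999, §2.2; Evans
2010, §5.8.1): `‖f − f_P‖ ≤ 2‖f − c‖` with `c` the Lebesgue average over `Q` of a global `C¹`
extension of the composite representative `f ∘ φ⁻¹ ∘ Ψ⁻¹`; the composite change of variables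
(`setLIntegral_compositeChart`) has density `|det DΨ⁻¹| √det(h_ij) ∈ [λ, Λ]` on `Q̄`
(`exists_compositeDensity_bounds`); the Euclidean Poincaré–Wirtinger inequality on the convex `Q`
(`lintegral_enorm_sub_setAverage_sq_le`); and `λ' ‖∇(f ∘ φ⁻¹ ∘ Ψ⁻¹)‖² ≤ h⁻¹(df, df)`
(`exists_gradSq_compositeChart_bounds`). The point of the composite version: with `Ψ` a
boundary-flattening chart of a regular sublevel domain `{σ < 0}` and `Q` a half-ball, `P` is the
part of `{σ < 0}` in a coordinate ball (`sublevel_inter_compositePiece`), which gives the Poincaré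
inequality on `{σ < 0}` by the finite-cover gluing of `PoincareGluing.lean`.

## References

* E. Hebey, *Nonlinear Analysis on Manifolds: Sobolev Spaces and Inequalities* (1999), §2.2.
* L. C. Evans, *Partial Differential Equations*, 2nd ed. (2010), §5.8.1. [Evans2010]
-/

noncomputable section

open MeasureTheory Measure Set Filter Metric Module InnerProductSpace
open scoped ENNReal NNReal Manifold ContDiff Topology RealInnerProductSpace

namespace Literature.Geometry.Riemannian

open Lorentzian
open Bundle PseudoRiemannianMetric Literature.Analysis.FunctionSpaces Literature.Geometry.Manifold

variable {m : ℕ} {M : Type*} [TopologicalSpace M] [ChartedSpace (EuclideanSpace ℝ (Fin m)) M]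
  [IsManifold (𝓡 m) ∞ M] [T2Space M] [LocallyCompactSpace M] [MeasurableSpace M] [BorelSpace M]

/-- `‖f‖_{L²(μ)}² = ∫ ‖f‖ₑ²`. [folklore] -/
private theorem eLpNorm_two_sq_eq_lintegral' {α : Type*} [MeasurableSpace α] {μ : Measure α}
    {ε : Type*} [ENorm ε] (f : α → ε) : eLpNorm f 2 μ ^ 2 = ∫⁻ x, ‖f x‖ₑ ^ 2 ∂μ := by
  rw [eLpNorm_eq_lintegral_rpow_enorm_toReal (by norm_num) (by norm_num), ENNReal.toReal_ofNat,
    ← ENNReal.rpow_natCast, ← ENNReal.rpow_mul]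
  norm_num

/-- If `X² ≤ Y` in `[0, ∞]` then `X ≤ Y^{1/2}`. [folklore] -/
private theorem le_rpow_half_of_sq_le' {X Y : ℝ≥0∞} (h : X ^ 2 ≤ Y) : X ≤ Y ^ (1 / 2 : ℝ) := by
  have h1 : X = (X ^ 2) ^ (1 / 2 : ℝ) := by
    rw [← ENNReal.rpow_natCast, ← ENNReal.rpow_mul]
    norm_num
  rw [h1]
  exact ENNReal.rpow_le_rpow h (by norm_num)

/-- `‖∇F(w)‖ = ‖DF(w)‖` (Riesz isometry). [folklore] -/
private theorem norm_gradient_eq_norm_fderiv {E : Type*} [NormedAddCommGroup E]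
    [InnerProductSpace ℝ E] [CompleteSpace E] (F : E → ℝ) (w : E) :
    ‖gradient F w‖ = ‖fderiv ℝ F w‖ := by
  rw [gradient, LinearIsometryEquiv.norm_map]

variable (h : ContMDiffRiemannianMetric (𝓡 m) ∞ (EuclideanSpace ℝ (Fin m))
  (TangentSpace (𝓡 m) : M → Type _)) (x : M)

/-- **Poincaré–Wirtinger on a convex composite chart piece.** Let `h` be a smooth Riemannian
metric on `M` (modelled on `ℝᵐ`), `φ = extChartAt (𝓡 m) x`, `Ψ` a `C^∞` local diffeomorphism of
`ℝᵐ` with `C^∞` inverse and `Ψ.source ⊆ φ.target`, and `Q ⊆ ℝᵐ` open, convex, nonempty, with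
compact closure contained in `Ψ.target`; put `P = φ.source ∩ φ⁻¹(Ψ⁻¹ Q)`. There is `C < ∞` such
that for every `f ∈ C¹(M)`,
`‖f − ⨍_P f dμ_h‖_{L²(P, μ_h)} ≤ C (∫_P h⁻¹(df, df) dμ_h)^{1/2}`.
[cite: SchoenYauPMT1979, proof of Lemma 3.1 (p. 63)] -/
theorem exists_poincare_compositePiece
    {Ψ : OpenPartialHomeomorph (EuclideanSpace ℝ (Fin m)) (EuclideanSpace ℝ (Fin m))}
    (hΨt : Ψ.source ⊆ (extChartAt (𝓡 m) x).target) (hΨ : ContDiffOn ℝ ∞ Ψ Ψ.source)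
    (hΨ' : ContDiffOn ℝ ∞ Ψ.symm Ψ.target)
    {Q : Set (EuclideanSpace ℝ (Fin m))} (hQo : IsOpen Q) (hQc : Convex ℝ Q) (hQne : Q.Nonempty)
    (hK : IsCompact (closure Q)) (hKt : closure Q ⊆ Ψ.target) :
    ∃ C : ℝ≥0∞, C ≠ ⊤ ∧ ∀ f : M → ℝ, ContMDiff (𝓡 m) 𝓘(ℝ, ℝ) 1 f →
      eLpNorm (fun p ↦ f p - ⨍ q in (extChartAt (𝓡 m) x).source ∩
          extChartAt (𝓡 m) x ⁻¹' (Ψ.symm '' Q), f q ∂riemannianMeasure h) 2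
        ((riemannianMeasure h).restrict
          ((extChartAt (𝓡 m) x).source ∩ extChartAt (𝓡 m) x ⁻¹' (Ψ.symm '' Q))) ≤
      C * (∫⁻ p in (extChartAt (𝓡 m) x).source ∩ extChartAt (𝓡 m) x ⁻¹' (Ψ.symm '' Q),
        ENNReal.ofReal ((PseudoRiemannianMetric.ofRiemannian h).innerDual p
          (mvfderiv (𝓡 m) f p).toLinearMap (mvfderiv (𝓡 m) f p).toLinearMap)
            ∂riemannianMeasure h) ^ (1 / 2 : ℝ) := by
  classical
  set g := PseudoRiemannianMetric.ofRiemannian h with hg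
  set ψ := extChartAt (𝓡 m) x with hψ
  set T : Set (EuclideanSpace ℝ (Fin m)) := Ψ.target with hT
  have hTo : IsOpen T := Ψ.open_target
  set K := closure Q with hKdef
  set P : Set M := ψ.source ∩ ψ ⁻¹' (Ψ.symm '' Q) with hP
  set μ : Measure M := riemannianMeasure h with hμ
  have hQm : MeasurableSet Q := hQo.measurableSet
  have hQK : Q ⊆ K := subset_closure
  have hQT : Q ⊆ T := hQK.trans hKt
  have hΨd : DifferentiableOn ℝ Ψ Ψ.source := hΨ.differentiableOn (by simp)
  have hΨ'1 : ContDiffOn ℝ 1 Ψ.symm Ψ.target := hΨ'.of_le (by norm_cast)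
  have hΨ'd : DifferentiableOn ℝ Ψ.symm Ψ.target := hΨ'.differentiableOn (by simp)
  have hPm : MeasurableSet P := (isOpen_compositePiece (x₀ := x) hQo hQT).measurableSet
  have hμP : μ P ≠ ⊤ :=
    (riemannianMeasure_compositeChart_piece_lt_top h x hΨt hΨd hΨ'1 hQm hQK hK hKt).ne
  -- comparison constants on `K`
  obtain ⟨lam, Lam, hlam, -, hdens⟩ := exists_compositeDensity_bounds h x hΨt hΨd hΨ'1 hK hKt
  obtain ⟨lam', Lam', hlam', -, hgrad⟩ := exists_gradSq_compositeChart_bounds h x hΨt hΨ hΨ' hK hKt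
  -- a diameter bound for `Q`
  obtain ⟨R, hR⟩ := (Metric.isBounded_iff_subset_closedBall (0 : EuclideanSpace ℝ (Fin m))).1
    hK.isBounded
  have hD : ∀ y ∈ Q, ∀ z ∈ Q, ‖y - z‖ ≤ 2 * |R| := by
    intro y hy z hz
    have hy' := mem_closedBall_zero_iff.1 (hR (hQK hy))
    have hz' := mem_closedBall_zero_iff.1 (hR (hQK hz))
    calc ‖y - z‖ ≤ ‖y‖ + ‖z‖ := norm_sub_le _ _
      _ ≤ 2 * |R| := by linarith [le_abs_self R]
  have hvolQ0 : (volume : Measure (EuclideanSpace ℝ (Fin m))) Q ≠ 0 :=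
    (hQo.measure_pos volume hQne).ne'
  have hvolQt : (volume : Measure (EuclideanSpace ℝ (Fin m))) Q ≠ ⊤ :=
    ((measure_mono hQK).trans_lt hK.measure_lt_top).ne
  -- the constant
  set C₀ : ℝ≥0∞ := ENNReal.ofReal Lam * ENNReal.ofReal (2 ^ finrank ℝ (EuclideanSpace ℝ (Fin m)) *
    (2 * |R|) ^ 2) * ENNReal.ofReal (1 / lam') * ENNReal.ofReal (1 / lam) with hC₀
  have hC₀t : C₀ ≠ ⊤ := by
    simp only [hC₀]
    exact ENNReal.mul_ne_top (ENNReal.mul_ne_top (ENNReal.mul_ne_top ENNReal.ofReal_ne_top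
      ENNReal.ofReal_ne_top) ENNReal.ofReal_ne_top) ENNReal.ofReal_ne_top
  refine ⟨2 * C₀ ^ (1 / 2 : ℝ), ENNReal.mul_ne_top (by norm_num)
    (ENNReal.rpow_ne_top_of_nonneg (by norm_num) hC₀t), fun f hf ↦ ?_⟩
  have hfc : Continuous f := hf.continuous
  -- the composite representative and a global `C¹` extension near `K`
  set F : EuclideanSpace ℝ (Fin m) → ℝ := f ∘ ψ.symm ∘ Ψ.symm with hF
  have hF1 : ContDiffOn ℝ 1 F T := by
    have h1 : ContDiffOn ℝ 1 (f ∘ ψ.symm) ψ.target := contDiffOn_comp_extChartAt_symm hf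
    have h2 : ContDiffOn ℝ 1 (fun w => (f ∘ ψ.symm) (Ψ.symm w)) T :=
      h1.comp hΨ'1 fun w hw => hΨt (Ψ.map_target hw)
    exact h2
  obtain ⟨G, hG1, V, hVo, hKV, hVT, hGF⟩ := exists_contDiff_eqOn_of_isCompact hTo hK hKt hF1
  have hGFQ : ∀ y ∈ Q, G y = F y := fun y hy ↦ hGF (hKV (hQK hy))
  have hDGQ : ∀ y ∈ Q, fderiv ℝ G y = fderiv ℝ F y := by
    intro y hy
    have hev : G =ᶠ[𝓝 y] F :=
      Filter.eventuallyEq_of_mem ((hVo.mem_nhds (hKV (hQK hy)))) hGF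
    exact hev.fderiv_eq
  -- the Euclidean Poincaré–Wirtinger inequality for `G` on `Q`
  have hGi : IntegrableOn G Q volume :=
    (hG1.continuous.continuousOn.integrableOn_compact hK).mono_set hQK
  have hPW := lintegral_enorm_sub_setAverage_sq_le (μ := (volume : Measure (EuclideanSpace ℝ (Fin m))))
    hG1 hQc hQm hvolQ0 hvolQt hGi hD
  set c : ℝ := ⨍ z in Q, G z with hc
  -- integrability of `f` on `P`
  have hfi : IntegrableOn f P μ := by
    have hcont : ContinuousOn (fun w => ψ.symm (Ψ.symm w)) K :=
      (continuousOn_extChartAt_symm x).comp (Ψ.continuousOn_symm.mono hKt)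
        fun w hw => hΨt (Ψ.map_target (hKt hw))
    have himg : IsCompact ((fun w => ψ.symm (Ψ.symm w)) '' K) := hK.image_of_continuousOn hcont
    have hsub : P ⊆ (fun w => ψ.symm (Ψ.symm w)) '' K := by
      rintro p ⟨hp, w, hwQ, hw⟩
      exact ⟨w, hQK hwQ, by simp only [hw, ψ.left_inv hp]⟩
    haveI : IsFiniteMeasureOnCompacts μ :=
      ⟨fun K' hK' ↦ riemannianVolume_lt_top_of_isCompact_holds h le_rfl hK'⟩
    exact (hfc.continuousOn.integrableOn_compact himg).mono_set hsub
  -- Step A: replace the average by the constant `c`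
  have hA := eLpNorm_sub_setAverage_le_two_mul (μ := μ) hμP one_le_two hfi c
  -- Step B: `‖f − c‖²_{L²(P)} ≤ C₀ ∫_P h⁻¹(df, df)`
  have hB : eLpNorm (fun p ↦ f p - c) 2 (μ.restrict P) ^ 2 ≤
      C₀ * ∫⁻ p in P, ENNReal.ofReal (g.innerDual p (mvfderiv (𝓡 m) f p).toLinearMap
        (mvfderiv (𝓡 m) f p).toLinearMap) ∂μ := by
    rw [eLpNorm_two_sq_eq_lintegral']
    -- to the composite chart
    have hmeas : Measurable fun p ↦ (‖f p - c‖ₑ : ℝ≥0∞) ^ 2 :=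
      (hfc.sub continuous_const).measurable.enorm.pow_const 2
    have h1 : ∫⁻ p in P, ‖f p - c‖ₑ ^ 2 ∂μ =
        ∫⁻ w in Q, ENNReal.ofReal |(fderiv ℝ Ψ.symm w).det| * (‖F w - c‖ₑ ^ 2 *
          ENNReal.ofReal (Real.sqrt (chartGramMatrix h x (Ψ.symm w)).det)) := by
      have h := setLIntegral_compositeChart h x hΨt hΨ'd hQm hQT hmeas
      simpa only [hF, Function.comp_apply] using h
    -- density `≤ Λ`, and `F = G` on `Q`
    have h2 : ∫⁻ w in Q, ENNReal.ofReal |(fderiv ℝ Ψ.symm w).det| * (‖F w - c‖ₑ ^ 2 *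
          ENNReal.ofReal (Real.sqrt (chartGramMatrix h x (Ψ.symm w)).det)) ≤
        ENNReal.ofReal Lam * ∫⁻ y in Q, ‖G y - ⨍ z in Q, G z‖ₑ ^ 2 := by
      rw [← lintegral_const_mul' _ _ ENNReal.ofReal_ne_top]
      refine setLIntegral_mono' hQm fun y hy ↦ ?_
      rw [hGFQ y hy, ← hc]
      calc ENNReal.ofReal |(fderiv ℝ Ψ.symm y).det| * (‖F y - c‖ₑ ^ 2 *
            ENNReal.ofReal (Real.sqrt (chartGramMatrix h x (Ψ.symm y)).det))
          = ENNReal.ofReal (|(fderiv ℝ Ψ.symm y).det| *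
              Real.sqrt (chartGramMatrix h x (Ψ.symm y)).det) * ‖F y - c‖ₑ ^ 2 := by
            rw [ENNReal.ofReal_mul (abs_nonneg _)]; ring
        _ ≤ ENNReal.ofReal Lam * ‖F y - c‖ₑ ^ 2 := by
            gcongr
            exact (hdens y (hQK hy)).2
    -- Poincaré–Wirtinger, then back to `F` and to `h⁻¹(df, df)`
    have h3 : ∫⁻ y in Q, (‖fderiv ℝ G y‖ₑ : ℝ≥0∞) ^ 2 ≤
        ENNReal.ofReal (1 / lam') * ∫⁻ y in Q, ENNReal.ofReal (g.innerDual (ψ.symm (Ψ.symm y))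
          (mvfderiv (𝓡 m) f (ψ.symm (Ψ.symm y))).toLinearMap
          (mvfderiv (𝓡 m) f (ψ.symm (Ψ.symm y))).toLinearMap) := by
      rw [← lintegral_const_mul' _ _ ENNReal.ofReal_ne_top]
      refine setLIntegral_mono' hQm fun y hy ↦ ?_
      rw [hDGQ y hy]
      have hmd : MDifferentiableAt (𝓡 m) 𝓘(ℝ, ℝ) f (ψ.symm (Ψ.symm y)) :=
        hf.mdifferentiableAt one_ne_zero
      have hlow := (hgrad y (hQK hy) f hmd).1
      rw [norm_gradient_eq_norm_fderiv] at hlow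
      have h0 : 0 ≤ g.innerDual (ψ.symm (Ψ.symm y)) (mvfderiv (𝓡 m) f (ψ.symm (Ψ.symm y))).toLinearMap
          (mvfderiv (𝓡 m) f (ψ.symm (Ψ.symm y))).toLinearMap :=
        le_trans (mul_nonneg hlam'.le (sq_nonneg _)) hlow
      rw [← ofReal_norm, ← ENNReal.ofReal_pow (norm_nonneg _),
        ← ENNReal.ofReal_mul (by positivity)]
      refine ENNReal.ofReal_le_ofReal ?_
      rw [one_div, inv_mul_eq_div, le_div_iff₀ hlam', mul_comm]
      exact hlow
    have h4 : ∫⁻ y in Q, ENNReal.ofReal (g.innerDual (ψ.symm (Ψ.symm y))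
          (mvfderiv (𝓡 m) f (ψ.symm (Ψ.symm y))).toLinearMap
          (mvfderiv (𝓡 m) f (ψ.symm (Ψ.symm y))).toLinearMap) ≤
        ENNReal.ofReal (1 / lam) * ∫⁻ y in Q, ENNReal.ofReal |(fderiv ℝ Ψ.symm y).det| *
          (ENNReal.ofReal (g.innerDual (ψ.symm (Ψ.symm y))
            (mvfderiv (𝓡 m) f (ψ.symm (Ψ.symm y))).toLinearMap
            (mvfderiv (𝓡 m) f (ψ.symm (Ψ.symm y))).toLinearMap) *
          ENNReal.ofReal (Real.sqrt (chartGramMatrix h x (Ψ.symm y)).det)) := by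
      rw [← lintegral_const_mul' _ _ ENNReal.ofReal_ne_top]
      refine setLIntegral_mono' hQm fun y hy ↦ ?_
      have hρ := (hdens y (hQK hy)).1
      set X := ENNReal.ofReal (g.innerDual (ψ.symm (Ψ.symm y))
            (mvfderiv (𝓡 m) f (ψ.symm (Ψ.symm y))).toLinearMap
            (mvfderiv (𝓡 m) f (ψ.symm (Ψ.symm y))).toLinearMap) with hX
      have hre : ENNReal.ofReal |(fderiv ℝ Ψ.symm y).det| * (X *
          ENNReal.ofReal (Real.sqrt (chartGramMatrix h x (Ψ.symm y)).det)) =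
          ENNReal.ofReal (|(fderiv ℝ Ψ.symm y).det| *
            Real.sqrt (chartGramMatrix h x (Ψ.symm y)).det) * X := by
        rw [ENNReal.ofReal_mul (abs_nonneg _)]; ring
      rw [hre]
      calc X = ENNReal.ofReal (1 / lam) * ENNReal.ofReal lam * X := by
            rw [← ENNReal.ofReal_mul (by positivity), one_div, inv_mul_cancel₀ hlam.ne',
              ENNReal.ofReal_one, one_mul]
        _ ≤ ENNReal.ofReal (1 / lam) * (ENNReal.ofReal (|(fderiv ℝ Ψ.symm y).det| *
            Real.sqrt (chartGramMatrix h x (Ψ.symm y)).det) * X) := by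
            rw [mul_assoc]
            gcongr
    have hmeasI : Measurable fun p ↦ ENNReal.ofReal (g.innerDual p (mvfderiv (𝓡 m) f p).toLinearMap
        (mvfderiv (𝓡 m) f p).toLinearMap) :=
      ENNReal.measurable_ofReal.comp (continuous_innerDual_mvfderiv g hf hf).measurable
    have h5 : ∫⁻ y in Q, ENNReal.ofReal |(fderiv ℝ Ψ.symm y).det| *
          (ENNReal.ofReal (g.innerDual (ψ.symm (Ψ.symm y))
            (mvfderiv (𝓡 m) f (ψ.symm (Ψ.symm y))).toLinearMap
            (mvfderiv (𝓡 m) f (ψ.symm (Ψ.symm y))).toLinearMap) *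
          ENNReal.ofReal (Real.sqrt (chartGramMatrix h x (Ψ.symm y)).det)) =
        ∫⁻ p in P, ENNReal.ofReal (g.innerDual p (mvfderiv (𝓡 m) f p).toLinearMap
          (mvfderiv (𝓡 m) f p).toLinearMap) ∂μ :=
      (setLIntegral_compositeChart h x hΨt hΨ'd hQm hQT hmeasI).symm
    calc ∫⁻ p in P, ‖f p - c‖ₑ ^ 2 ∂μ
        = ∫⁻ w in Q, ENNReal.ofReal |(fderiv ℝ Ψ.symm w).det| * (‖F w - c‖ₑ ^ 2 *
          ENNReal.ofReal (Real.sqrt (chartGramMatrix h x (Ψ.symm w)).det)) := h1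
      _ ≤ ENNReal.ofReal Lam * ∫⁻ y in Q, ‖G y - ⨍ z in Q, G z‖ₑ ^ 2 := h2
      _ ≤ ENNReal.ofReal Lam * (ENNReal.ofReal (2 ^ finrank ℝ (EuclideanSpace ℝ (Fin m)) *
          (2 * |R|) ^ 2) * ∫⁻ y in Q, (‖fderiv ℝ G y‖ₑ : ℝ≥0∞) ^ 2) := by gcongr
      _ ≤ ENNReal.ofReal Lam * (ENNReal.ofReal (2 ^ finrank ℝ (EuclideanSpace ℝ (Fin m)) *
          (2 * |R|) ^ 2) * (ENNReal.ofReal (1 / lam') * (ENNReal.ofReal (1 / lam) *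
          ∫⁻ p in P, ENNReal.ofReal (g.innerDual p (mvfderiv (𝓡 m) f p).toLinearMap
            (mvfderiv (𝓡 m) f p).toLinearMap) ∂μ))) := by
          gcongr
          exact h3.trans (mul_le_mul_right (h4.trans (by rw [h5])) _)
      _ = C₀ * ∫⁻ p in P, ENNReal.ofReal (g.innerDual p (mvfderiv (𝓡 m) f p).toLinearMap
            (mvfderiv (𝓡 m) f p).toLinearMap) ∂μ := by
          simp only [hC₀]
          ring
  -- Step C: assemble
  calc eLpNorm (fun p ↦ f p - ⨍ q in P, f q ∂μ) 2 (μ.restrict P)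
      ≤ 2 * eLpNorm (fun p ↦ f p - c) 2 (μ.restrict P) := hA
    _ ≤ 2 * (C₀ * ∫⁻ p in P, ENNReal.ofReal (g.innerDual p (mvfderiv (𝓡 m) f p).toLinearMap
          (mvfderiv (𝓡 m) f p).toLinearMap) ∂μ) ^ (1 / 2 : ℝ) := by
        gcongr
        exact le_rpow_half_of_sq_le' hB
    _ = 2 * C₀ ^ (1 / 2 : ℝ) * (∫⁻ p in P, ENNReal.ofReal (g.innerDual p
          (mvfderiv (𝓡 m) f p).toLinearMap (mvfderiv (𝓡 m) f p).toLinearMap) ∂μ) ^ (1 / 2 : ℝ) := by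
        rw [ENNReal.mul_rpow_of_nonneg _ _ (by norm_num), mul_assoc]

end Literature.Geometry.Riemannian

end
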